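import Summits.Ventures.LatticeQCDFlow.TrivializingMaps.FisherRadiusCap

/-!
HONEST FRAMING: exact (Metropolis-corrected) sampling algorithms for lattice gauge theory; figures
of merit are autocorrelation/cost numbers at stated couplings and volumes; no continuum-physics
claim.

# FisherRadiusExact — THEOREM F″ (THEORY-1.md §13.1 / §24): Lüscher's flow constants are the
Taylor coefficients of `Z′/Z`, and their series converges EXACTLY up to the first Fisher zero

Proposed tree path: `Summits/Ventures/LatticeQCDFlow/TrivializingMaps/FisherRadiusExact.lean` (OURS —
venture-side, never `Literature/`). Companion of `FisherRadiusIdentity` (THEOREM F, exact finite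
form `Z′(s) = (∑_{k≤N} Ċ^{(k)} s^k) Z(s) + s^{N+1} J_N(s)`), `FisherRadiusCap` (THEOREM F′: a
geometric GRADIENT bound of ratio `ρ⁻¹` forces `Z ≠ 0` on `|s| < ρ`) and `FisherObstruction`.
Cell `lqcd-flow` (pub-lqcd), unit `pub-lqcd-theory1-g15`, 2026-08-21.

Setting ([Luscher2010Trivializing] §2, §4): a smooth action `S` on `SU(n)^E` (periodic lattice
`(ℤ/L)^d`), Lüscher's trivial theory `D[U]`, a smooth LÜSCHER SERIES `(S^{(k)}, Ċ^{(k)})_k` of `S`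
(`IsLuscherSeries B S Sk c`, the recursion (4.12)–(4.15)), and the complexified partition function
of the flow `S_t = tS`, `Z(s) = ∫ D[U] e^{-sS} = complexMGF (-S) D[U] s` — entire, `Z(0) = 1`.
NO hypothesis on the gradients `∂S^{(k)}` is made in this file (the difference to THEOREM F′).

Results (all `[ours]`; elementary complex analysis on top of THEOREM F):
* `differentiable_integral_cexp_mul`: `w ↦ ∫ D[U] e^{-wS} F` (`F` continuous) is entire — so
  are THEOREM F's remainder pairings `J_N`.
* **`IsLuscherSeries.iteratedDeriv_logDeriv_actionZ_eq` (F″(i), Cauchy's formula for the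
  constants):** if `Z ≠ 0` on a closed disc `|w| ≤ r`, `r > 0` (such `r` always exists), then
  `(d/ds)^N (Z′/Z)(0) = N! · Ċ^{(N)}` for EVERY `N`: the flow constants of ANY smooth Lüscher series
  are the Taylor coefficients at `β = 0` of `(log Z)′ = -⟨S⟩_s` (`deriv_actionZ_eq`), i.e. the
  strong-coupling expansion coefficients of minus the mean action (`∮_{|w|=r} w^{-N-1}(Z′/Z) dw =
  ∮ w^{-N-1} ∑_{k≤N} Ċ^{(k)} w^k dw + ∮ J_N/Z dw = 2πi Ċ^{(N)} + 0`).
* **`IsLuscherSeries.hasSum_const_mul_pow_of_zeroFree` (F″(ii), exact convergence):** `Z ≠ 0` on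
  `|w| < R` ⇒ `∑_k Ċ^{(k)} s^k = Z′(s)/Z(s)` for every `|s| < R` (Taylor's theorem on the
  zero-free disc); real form `…_real_of_zeroFree`: `Ċ_t = -⟨S⟩_{tS}` for real `|t| < R`.
* **`IsLuscherSeries.not_summable_const_mul_pow_of_actionZ_eq_zero` (F″(iii), exact
  divergence):** `Z(s₀) = 0` ⇒ `∑_k Ċ^{(k)} s^k` is NOT summable at any complex `|s| > |s₀|`
  (bounded terms would give a holomorphic `g` with `Z′ = gZ` near `0` by (ii), on a disc containing
  `s₀` by the identity theorem, and `Fisher.zeroFree_of_flowConstant` forbids the zero). With (ii):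
  **the radius of convergence of `∑_k Ċ^{(k)} s^k` is EXACTLY `min {|s₀| : Z(s₀) = 0}`** (the
  nearest Fisher zero of the finite-volume partition function; `∞` iff none), for every smooth
  action and volume. THEOREM F′ capped every THEOREM-A-type geometric radius by this number; F″ says
  the cap is attained by the constants' component of Lüscher's equation. For the gradient series
  (the map itself) only `≤` is known (F′; equality is the E-type question of THEORY-1 §14).
* Wilson action (`S_W = ∑_p Re tr(1 - U_p)`, `s = β/N` for the conventional
  `β ∑_p (1 - N⁻¹ Re tr U_p)`; canonical series `wilsonSk / wilsonConst`):
  `wilson_const_hasSum_of_zeroFree` (zero-free disc of `Z_L` ⇒ convergence of the volume-`L`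
  constants on it: a VOLUME-UNIFORM zero-free disc gives volume-uniform convergence — the converse
  of F′ for the constants), `wilson_const_not_summable_of_actionZ_eq_zero`,
  `wilson_const_not_summable_real` (a zero `s₀` of `Z_L` ⇒ `∑_k Ċ^{(k)}_L t^k` DIVERGES at every
  real `|t| > |s₀|`). Printed (MCMC-located, non-rigorous) leading zeros of `Z_4` on the symmetric
  `4⁴` lattice — `SU(2)`: `β₀ = 2.18(1) ± 0.18(2)i`, `SU(3)`: `β₀ = 5.54(2) ± 0.10(2)i`
  (Denbleyker–Du–Liu–Meurice–Velytsky, arXiv:0710.5771, p. 5; `SU(3)`: `5.550(3) ± 0.098(4)i`,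
  Alves–Berg–Sanielevici, Nucl. Phys. B376 (1992) 218, arXiv:hep-lat/9107002, Table 8) — are NOT
  used here; THEORY-1 §24 feeds them in (ANY zero bounds the radius: `≤ |s₀| = |β₀|/N ≈ 1.09`
  resp. `1.85 < 2 = s(β = 6)`) with that caveat. No physics claim.

References: M. Lüscher, Commun. Math. Phys. 293 (2010) 899–919, §4.2–§4.5 [bib
`Luscher2010Trivializing`]; M. E. Fisher, Lectures in Theoretical Physics VII C (1965);
THEORY-1.md §13.1 (THEOREM F/F′), §24 (THEOREM F″).
-/

open MeasureTheory ProbabilityTheory Filter Topology Complex Set Metric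
open Literature.MathematicalPhysics.QuantumFieldTheory
open Literature.MathematicalPhysics.QuantumFieldTheory.Luscher2010
open Literature.MathematicalPhysics.QuantumFieldTheory.WilsonFlow (coeConfig continuous_coeConfig)
open scoped Matrix Matrix.Norms.Frobenius ContDiff

namespace Summit.Ventures.LatticeQCDFlow.TrivializingMaps

variable {d L n : ℕ}

section General

variable [NeZero L] {B : SuBasis n} {S : AmbConfig d L n → ℝ} {Sk : ℕ → AmbConfig d L n → ℝ}
  {c : ℕ → ℝ}

/-- **Weighted partition integrals are entire**: for smooth `S` and continuous `F`,
`w ↦ ∫ D[U] e^{-wS} F` is complex-differentiable on `ℂ` (dominated differentiation). [folklore] -/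
theorem differentiable_integral_cexp_mul (hS : ContDiff ℝ ∞ S)
    {F : GaugeConfig d L (Matrix.specialUnitaryGroup (Fin n) ℂ) → ℂ} (hF : Continuous F) :
    Differentiable ℂ fun w : ℂ => ∫ U, cexp (-(w * (S (coeConfig U) : ℂ))) * F U
      ∂(trivialMeasure (Matrix.specialUnitaryGroup (Fin n) ℂ) d L) := by
  obtain ⟨b, hb⟩ := exists_abs_le_of_contDiff hS
  obtain ⟨M, hM⟩ := (isCompact_range hF.norm).bddAbove
  have hSc : Continuous fun U : GaugeConfig d L (Matrix.specialUnitaryGroup (Fin n) ℂ) =>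
      (S (coeConfig U) : ℂ) := continuous_ofReal.comp (continuous_comp_coeConfig hS)
  have hint : ∀ w : ℂ, Integrable (fun U => cexp (-(w * (S (coeConfig U) : ℂ))) * F U)
      (trivialMeasure (Matrix.specialUnitaryGroup (Fin n) ℂ) d L) := fun w =>
    integrable_trivialMeasure_of_continuous_complex (((continuous_const.mul hSc).neg.cexp).mul hF)
  have hint' : ∀ w : ℂ, Integrable
      (fun U => cexp (-(w * (S (coeConfig U) : ℂ))) * -(S (coeConfig U) : ℂ) * F U)
      (trivialMeasure (Matrix.specialUnitaryGroup (Fin n) ℂ) d L) := fun w =>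
    integrable_trivialMeasure_of_continuous_complex
      ((((continuous_const.mul hSc).neg.cexp).mul hSc.neg).mul hF)
  intro w₀
  refine ((hasDerivAt_integral_of_dominated_loc_of_deriv_le
    (F := fun w U => cexp (-(w * (S (coeConfig U) : ℂ))) * F U)
    (F' := fun w U => cexp (-(w * (S (coeConfig U) : ℂ))) * -(S (coeConfig U) : ℂ) * F U)
    (bound := fun _ => Real.exp ((‖w₀‖ + 1) * b) * b * M)
    (ball_mem_nhds w₀ zero_lt_one) (Eventually.of_forall fun w => (hint w).aestronglyMeasurable)
    (hint w₀) (hint' w₀).aestronglyMeasurable (ae_of_all _ fun U w hw => ?_) (integrable_const _)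
    (ae_of_all _ fun U w _ => ?_)).2).differentiableAt
  · have hw1 : ‖w - w₀‖ < 1 := mem_ball_iff_norm.mp hw
    have hw2 : ‖w‖ ≤ ‖w - w₀‖ + ‖w₀‖ := by simpa using norm_add_le (w - w₀) w₀
    have h1 : (-(w * (S (coeConfig U) : ℂ))).re ≤ (‖w₀‖ + 1) * b :=
      calc (-(w * (S (coeConfig U) : ℂ))).re ≤ ‖-(w * (S (coeConfig U) : ℂ))‖ := re_le_norm _
        _ = ‖w‖ * |S (coeConfig U)| := by rw [norm_neg, norm_mul, norm_real, Real.norm_eq_abs]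
        _ ≤ (‖w₀‖ + 1) * b :=
          mul_le_mul (by linarith) (hb U) (abs_nonneg _) (by positivity)
    calc ‖cexp (-(w * (S (coeConfig U) : ℂ))) * -(S (coeConfig U) : ℂ) * F U‖
        = Real.exp ((-(w * (S (coeConfig U) : ℂ))).re) * |S (coeConfig U)| * ‖F U‖ := by
          rw [norm_mul, norm_mul, norm_neg, norm_real, Real.norm_eq_abs, norm_exp]
      _ ≤ Real.exp ((‖w₀‖ + 1) * b) * b * M :=
          mul_le_mul (mul_le_mul (Real.exp_le_exp.mpr h1) (hb U) (abs_nonneg _)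
            (Real.exp_pos _).le) (hM ⟨U, rfl⟩) (norm_nonneg _)
            (mul_nonneg (Real.exp_pos _).le ((abs_nonneg _).trans (hb U)))
  · exact ((((hasDerivAt_id' w).mul_const (S (coeConfig U) : ℂ)).fun_neg.cexp).mul_const
      (F U)).congr_deriv (by rw [one_mul])

/-- `Z(0) = 1`. [folklore] -/
theorem actionZ_zero (S : AmbConfig d L n → ℝ) :
    complexMGF (fun U => -S (coeConfig U))
      (trivialMeasure (Matrix.specialUnitaryGroup (Fin n) ℂ) d L) 0 = 1 := by
  rw [complexMGF_neg_action_eq]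
  simp

/-- `Z′` is entire (as the derivative of the entire `Z`). [folklore] -/
theorem differentiable_deriv_actionZ (hS : ContDiff ℝ ∞ S) :
    Differentiable ℂ (deriv (complexMGF (fun U => -S (coeConfig U))
      (trivialMeasure (Matrix.specialUnitaryGroup (Fin n) ℂ) d L))) :=
  differentiableOn_univ.mp
    (((differentiable_actionZ hS).differentiableOn.analyticOnNhd isOpen_univ).deriv.differentiableOn)

/-- **THEOREM F″(i) — Cauchy's formula for Lüscher's constants.** If `Z(s) = ∫ D[U] e^{-sS}` has
no zero on the closed disc `|w| ≤ r` (`r > 0`), then `(d/ds)^N (Z′/Z)(0) = N! · Ċ^{(N)}` for every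
`N` and every smooth Lüscher series of `S`: the flow constants are the Taylor coefficients at
`s = 0` of the logarithmic derivative of the partition function.
[cite: Luscher2010Trivializing, §4.2–§4.3 eqs. (4.9), (4.14)–(4.15)] -/
theorem IsLuscherSeries.iteratedDeriv_logDeriv_actionZ_eq (h : IsLuscherSeries B S Sk c)
    (hS : ContDiff ℝ ∞ S) (hSk : ∀ k, ContDiff ℝ ∞ (Sk k)) {r : ℝ} (hr : 0 < r)
    (hZ : ∀ w ∈ closedBall (0 : ℂ) r, complexMGF (fun U => -S (coeConfig U))
      (trivialMeasure (Matrix.specialUnitaryGroup (Fin n) ℂ) d L) w ≠ 0) (N : ℕ) :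
    iteratedDeriv N (fun w => deriv (complexMGF (fun U => -S (coeConfig U))
        (trivialMeasure (Matrix.specialUnitaryGroup (Fin n) ℂ) d L)) w /
      complexMGF (fun U => -S (coeConfig U))
        (trivialMeasure (Matrix.specialUnitaryGroup (Fin n) ℂ) d L) w) 0 = N.factorial * c N := by
  set Z := complexMGF (fun U => -S (coeConfig U))
    (trivialMeasure (Matrix.specialUnitaryGroup (Fin n) ℂ) d L) with hZdef
  obtain ⟨J, hJ⟩ : ∃ J : ℂ → ℂ, ∀ w, J w = ∑ e : Edge d L, ∑ a : B.ι,
      ∫ U, cexp (-(w * (S (coeConfig U) : ℂ))) *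
        ((linkDeriv e (B.T a) S (coeConfig U) * linkDeriv e (B.T a) (Sk N) (coeConfig U) : ℝ) : ℂ)
          ∂(trivialMeasure (Matrix.specialUnitaryGroup (Fin n) ℂ) d L) := ⟨_, fun _ => rfl⟩
  have hJd : Differentiable ℂ J := by
    rw [show J = _ from funext hJ]
    refine Differentiable.fun_sum fun e _ => Differentiable.fun_sum fun a _ => ?_
    exact differentiable_integral_cexp_mul hS (continuous_ofReal.comp
      ((continuous_comp_coeConfig (contDiff_linkDeriv hS e (B.T a))).mul
        (continuous_comp_coeConfig (contDiff_linkDeriv (hSk N) e (B.T a)))))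
  have hZd : Differentiable ℂ Z := differentiable_actionZ hS
  have hZ'd : Differentiable ℂ (deriv Z) := differentiable_deriv_actionZ hS
  have hf : DifferentiableOn ℂ (fun w => deriv Z w / Z w) (closedBall (0 : ℂ) r) :=
    hZ'd.differentiableOn.div hZd.differentiableOn hZ
  have hC := hf.circleIntegral_one_div_sub_center_pow_smul hr N
  have hsphere : EqOn (fun z => (1 / (z - 0) ^ (N + 1)) • (deriv Z z / Z z))
      (fun z => ∑ k ∈ Finset.range (N + 1), (c k : ℂ) * (z - 0) ^ ((k : ℤ) - (N + 1)) + J z / Z z)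
      (sphere (0 : ℂ) r) := by
    intro z hz
    have hz0 : z ≠ 0 := ne_of_mem_sphere hz hr.ne'
    have hZz : Z z ≠ 0 := hZ z (sphere_subset_closedBall hz)
    have hF : deriv Z z / Z z =
        ∑ k ∈ Finset.range (N + 1), (c k : ℂ) * z ^ k + z ^ (N + 1) * J z / Z z := by
      rw [hJ, hZdef, IsLuscherSeries.deriv_complexMGF_eq h hS hSk N z, add_div,
        mul_div_cancel_right₀ _ hZz]
    simp only [sub_zero, smul_eq_mul]
    rw [hF, mul_add, show 1 / z ^ (N + 1) * (z ^ (N + 1) * J z / Z z) = J z / Z z by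
      field_simp, Finset.mul_sum]
    congr 1
    refine Finset.sum_congr rfl fun k _ => ?_
    rw [zpow_sub₀ hz0, zpow_natCast, ← Nat.cast_add_one, zpow_natCast]
    ring
  have hmc : ∀ k, ContinuousOn (fun z => (c k : ℂ) * (z - 0) ^ ((k : ℤ) - (N + 1)))
      (sphere (0 : ℂ) r) := fun k =>
    continuousOn_const.mul ((continuousOn_id.sub continuousOn_const).zpow₀ _ fun z hz =>
      Or.inl (by simpa using ne_of_mem_sphere hz hr.ne'))
  have hI1 : ∀ k ∈ Finset.range (N + 1), CircleIntegrable
      (fun z => (c k : ℂ) * (z - 0) ^ ((k : ℤ) - (N + 1))) 0 r :=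
    fun k _ => (hmc k).circleIntegrable hr.le
  have hJZc : ContinuousOn (fun z => J z / Z z) (closedBall (0 : ℂ) r) :=
    hJd.continuous.continuousOn.div hZd.continuous.continuousOn hZ
  have hI2 : CircleIntegrable (fun z => J z / Z z) 0 r :=
    ContinuousOn.circleIntegrable hr.le (hJZc.mono sphere_subset_closedBall)
  have hint0 : (∮ z in C(0, r), J z / Z z) = 0 :=
    Complex.circleIntegral_eq_zero_of_differentiable_on_off_countable hr.le countable_empty hJZc
      fun z hz => (hJd z).div (hZd z) (hZ z (ball_subset_closedBall hz.1))
  have hmono : ∀ k ∈ Finset.range (N + 1),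
      (∮ z in C(0, r), (c k : ℂ) * (z - 0) ^ ((k : ℤ) - (N + 1))) =
        if k = N then 2 * (Real.pi : ℂ) * I * c k else 0 := by
    intro k _
    rw [circleIntegral.integral_const_mul]
    split_ifs with hkN
    · subst hkN
      rw [show ((k : ℤ) - (k + 1)) = -1 by ring]
      simp only [zpow_neg_one]
      rw [circleIntegral.integral_sub_center_inv 0 hr.ne']
      ring
    · rw [circleIntegral.integral_sub_zpow_of_ne (fun h => hkN (by omega)), mul_zero]
  have hLHS : (∮ z in C(0, r), (1 / (z - 0) ^ (N + 1)) • (deriv Z z / Z z)) =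
      2 * (Real.pi : ℂ) * I * c N := by
    rw [circleIntegral.integral_congr hr.le hsphere, circleIntegral.integral_add
      ((continuousOn_finsetSum _ fun k _ => hmc k).circleIntegrable hr.le) hI2,
      circleIntegral.integral_fun_sum hI1, hint0, add_zero, Finset.sum_congr rfl hmono,
      Finset.sum_ite_eq', if_pos (Finset.mem_range.mpr (Nat.lt_succ_self N))]
  rw [hLHS, smul_eq_mul] at hC
  have hN : (N.factorial : ℂ) ≠ 0 := by exact_mod_cast N.factorial_ne_zero
  have hq : (2 * (Real.pi : ℂ) * I / (N.factorial : ℂ)) ≠ 0 := div_ne_zero two_pi_I_ne_zero hN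
  apply mul_left_cancel₀ hq
  rw [← hC]
  field_simp

/-- **THEOREM F″(ii) — exact convergence on every zero-free disc.** If `Z(w) ≠ 0` for all
complex `|w| < R`, then `∑_k Ċ^{(k)} s^k = Z′(s)/Z(s)` for every smooth Lüscher series of `S` and
every `|s| < R` — no hypothesis on the gradients (contrast `IsLuscherSeries.hasSum_const_mul_pow`).
[cite: Luscher2010Trivializing, §4.2 eq. (4.9)] -/
theorem IsLuscherSeries.hasSum_const_mul_pow_of_zeroFree (h : IsLuscherSeries B S Sk c)
    (hS : ContDiff ℝ ∞ S) (hSk : ∀ k, ContDiff ℝ ∞ (Sk k)) {R : ℝ}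
    (hR : ∀ w : ℂ, ‖w‖ < R → complexMGF (fun U => -S (coeConfig U))
      (trivialMeasure (Matrix.specialUnitaryGroup (Fin n) ℂ) d L) w ≠ 0) {s : ℂ} (hs : ‖s‖ < R) :
    HasSum (fun k => (c k : ℂ) * s ^ k)
      (deriv (complexMGF (fun U => -S (coeConfig U))
          (trivialMeasure (Matrix.specialUnitaryGroup (Fin n) ℂ) d L)) s /
        complexMGF (fun U => -S (coeConfig U))
          (trivialMeasure (Matrix.specialUnitaryGroup (Fin n) ℂ) d L) s) := by
  set Z := complexMGF (fun U => -S (coeConfig U))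
    (trivialMeasure (Matrix.specialUnitaryGroup (Fin n) ℂ) d L) with hZdef
  have hf : DifferentiableOn ℂ (fun w => deriv Z w / Z w) (ball (0 : ℂ) R) :=
    (differentiable_deriv_actionZ hS).differentiableOn.div
      (differentiable_actionZ hS).differentiableOn fun w hw => hR w (mem_ball_zero_iff.mp hw)
  have hT := Complex.hasSum_taylorSeries_on_ball hf (mem_ball_zero_iff.mpr hs)
  obtain ⟨r, hsr, hrR⟩ := exists_between hs
  have hr0 : 0 < r := (norm_nonneg s).trans_lt hsr
  have hZr : ∀ w ∈ closedBall (0 : ℂ) r, Z w ≠ 0 := fun w hw =>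
    hR w ((mem_closedBall_zero_iff.mp hw).trans_lt hrR)
  have hfun : (fun k : ℕ => ((k.factorial : ℂ))⁻¹ • (s - 0) ^ k •
      iteratedDeriv k (fun w => deriv Z w / Z w) 0) = fun k => (c k : ℂ) * s ^ k := by
    funext k
    rw [IsLuscherSeries.iteratedDeriv_logDeriv_actionZ_eq h hS hSk hr0 hZr k, sub_zero, smul_eq_mul,
      smul_eq_mul]
    have hk : (k.factorial : ℂ) ≠ 0 := by exact_mod_cast k.factorial_ne_zero
    field_simp
  rw [hfun] at hT
  exact hT

/-- **THEOREM F″(ii), real form: `Ċ_t = -⟨S⟩_{tS}` below the first Fisher zero.** If `Z` is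
zero-free on `|w| < R`, then for real `|t| < R` the series `Ċ_t = ∑_k Ċ^{(k)} t^k` converges to
minus the mean action of the ensemble `e^{-tS} D[U]/Z(t)`. [cite: Luscher2010Trivializing, §4.2] -/
theorem IsLuscherSeries.hasSum_const_mul_pow_real_of_zeroFree (h : IsLuscherSeries B S Sk c)
    (hS : ContDiff ℝ ∞ S) (hSk : ∀ k, ContDiff ℝ ∞ (Sk k)) {R : ℝ}
    (hR : ∀ w : ℂ, ‖w‖ < R → complexMGF (fun U => -S (coeConfig U))
      (trivialMeasure (Matrix.specialUnitaryGroup (Fin n) ℂ) d L) w ≠ 0) {t : ℝ} (ht : |t| < R) :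
    HasSum (fun k => c k * t ^ k)
      (-(∫ U, Real.exp (-(t * S (coeConfig U))) * S (coeConfig U)
          ∂(trivialMeasure (Matrix.specialUnitaryGroup (Fin n) ℂ) d L)) /
        ∫ U, Real.exp (-(t * S (coeConfig U)))
          ∂(trivialMeasure (Matrix.specialUnitaryGroup (Fin n) ℂ) d L)) := by
  have hs : ‖(t : ℂ)‖ < R := by rwa [norm_real, Real.norm_eq_abs]
  have hc := IsLuscherSeries.hasSum_const_mul_pow_of_zeroFree h hS hSk hR hs
  rw [deriv_actionZ_eq hS, complexMGF_neg_action_eq] at hc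
  have h1 : ∫ U, cexp (-((t : ℂ) * (S (coeConfig U) : ℂ))) * (S (coeConfig U) : ℂ)
      ∂(trivialMeasure (Matrix.specialUnitaryGroup (Fin n) ℂ) d L) =
      ((∫ U, Real.exp (-(t * S (coeConfig U))) * S (coeConfig U)
        ∂(trivialMeasure (Matrix.specialUnitaryGroup (Fin n) ℂ) d L) : ℝ) : ℂ) := by
    rw [← integral_complex_ofReal]
    push_cast
    rfl
  have h2 : ∫ U, cexp (-((t : ℂ) * (S (coeConfig U) : ℂ)))
      ∂(trivialMeasure (Matrix.specialUnitaryGroup (Fin n) ℂ) d L) =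
      ((∫ U, Real.exp (-(t * S (coeConfig U)))
        ∂(trivialMeasure (Matrix.specialUnitaryGroup (Fin n) ℂ) d L) : ℝ) : ℂ) := by
    rw [← integral_complex_ofReal]
    push_cast
    rfl
  rw [h1, h2] at hc
  exact_mod_cast hc

/-- **THEOREM F″(iii) — exact divergence beyond the first Fisher zero.** If `Z(s₀) = 0`, then for
every smooth Lüscher series of `S` the series `∑_k Ċ^{(k)} s^k` is NOT summable at any complex
`|s| > |s₀|`; with F″(ii) its radius of convergence is exactly the modulus of the zero of `Z`
nearest to the origin. [cite: Luscher2010Trivializing, §4.5(b)] -/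
theorem IsLuscherSeries.not_summable_const_mul_pow_of_actionZ_eq_zero
    (h : IsLuscherSeries B S Sk c) (hS : ContDiff ℝ ∞ S) (hSk : ∀ k, ContDiff ℝ ∞ (Sk k))
    {s₀ : ℂ} (hz : complexMGF (fun U => -S (coeConfig U))
      (trivialMeasure (Matrix.specialUnitaryGroup (Fin n) ℂ) d L) s₀ = 0)
    {s : ℂ} (hs : ‖s₀‖ < ‖s‖) : ¬ Summable fun k => (c k : ℂ) * s ^ k := by
  set Z := complexMGF (fun U => -S (coeConfig U))
    (trivialMeasure (Matrix.specialUnitaryGroup (Fin n) ℂ) d L) with hZdef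
  intro hsum
  obtain ⟨M, hM⟩ : ∃ M : ℝ, ∀ k, ‖(c k : ℂ) * s ^ k‖ ≤ M := by
    obtain ⟨M, hM⟩ := hsum.tendsto_atTop_zero.norm.bddAbove_range
    exact ⟨M, fun k => hM ⟨k, rfl⟩⟩
  have hs0 : 0 < ‖s‖ := (norm_nonneg s₀).trans_lt hs
  have hsne : ‖s‖ ≠ 0 := hs0.ne'
  obtain ⟨r', hs₀r', hr's⟩ := exists_between hs
  have hr'0 : 0 < r' := (norm_nonneg _).trans_lt hs₀r'
  have hq0 : 0 ≤ r' / ‖s‖ := by positivity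
  have hq1 : r' / ‖s‖ < 1 := (div_lt_one hs0).mpr hr's
  have hg : DifferentiableOn ℂ (fun w => ∑' k, (c k : ℂ) * w ^ k) (ball (0 : ℂ) r') := by
    refine Complex.differentiableOn_tsum_of_summable_norm (u := fun k => M * (r' / ‖s‖) ^ k)
      ((summable_geometric_of_lt_one hq0 hq1).mul_left M)
      (fun k => ((differentiable_id.pow k).const_mul _).differentiableOn) isOpen_ball
      fun k w hw => ?_
    have hw' : ‖w‖ < r' := mem_ball_zero_iff.mp hw
    calc ‖(c k : ℂ) * w ^ k‖ = ‖(c k : ℂ)‖ * ‖w‖ ^ k := by rw [norm_mul, norm_pow]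
      _ ≤ ‖(c k : ℂ)‖ * r' ^ k := by gcongr
      _ = ‖(c k : ℂ) * s ^ k‖ * (r' / ‖s‖) ^ k := by
          rw [norm_mul, norm_pow, div_pow]
          field_simp
      _ ≤ M * (r' / ‖s‖) ^ k := by gcongr; exact hM k
  have hZd : Differentiable ℂ Z := differentiable_actionZ hS
  have hZ0 : Z 0 = 1 := actionZ_zero S
  obtain ⟨ρ₀, hρ₀, hZρ⟩ : ∃ ρ₀ > 0, ∀ w : ℂ, ‖w‖ < ρ₀ → Z w ≠ 0 := by
    have hev : ∀ᶠ w in 𝓝 (0 : ℂ), Z w ≠ 0 :=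
      hZd.continuous.continuousAt.eventually_ne (by rw [hZ0]; exact one_ne_zero)
    obtain ⟨ρ₀, hρ₀, hball⟩ := Metric.eventually_nhds_iff.mp hev
    exact ⟨ρ₀, hρ₀, fun w hw => hball (by simpa [dist_zero_right] using hw)⟩
  have hρ₁0 : 0 < min ρ₀ r' := lt_min hρ₀ hr'0
  have hsmall : ∀ w : ℂ, ‖w‖ < min ρ₀ r' →
      deriv Z w = (∑' k, (c k : ℂ) * w ^ k) * Z w := by
    intro w hw
    have hw0 : ‖w‖ < ρ₀ := lt_of_lt_of_le hw (min_le_left _ _)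
    rw [(IsLuscherSeries.hasSum_const_mul_pow_of_zeroFree h hS hSk hZρ hw0).tsum_eq,
      div_mul_cancel₀ _ (hZρ w hw0)]
  have hφ : AnalyticOnNhd ℂ (fun w => deriv Z w - (∑' k, (c k : ℂ) * w ^ k) * Z w)
      (ball (0 : ℂ) r') :=
    ((differentiable_deriv_actionZ hS).differentiableOn.sub
      (hg.mul hZd.differentiableOn)).analyticOnNhd isOpen_ball
  have hev0 : (fun w => deriv Z w - (∑' k, (c k : ℂ) * w ^ k) * Z w) =ᶠ[𝓝 0] 0 := by
    filter_upwards [Metric.ball_mem_nhds (0 : ℂ) hρ₁0] with w hw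
    rw [Pi.zero_apply, hsmall w (mem_ball_zero_iff.mp hw), sub_self]
  have hEq := hφ.eqOn_zero_of_preconnected_of_eventuallyEq_zero
    (convex_ball (0 : ℂ) r').isPreconnected (mem_ball_self hr'0) hev0
  have hflow : ∀ w ∈ ball (0 : ℂ) r', deriv Z w = (∑' k, (c k : ℂ) * w ^ k) * Z w :=
    fun w hw => by
      have hw' := hEq hw
      simp only [Pi.zero_apply] at hw'
      exact sub_eq_zero.mp hw'
  exact Fisher.zeroFree_of_flowConstant isOpen_ball (convex_ball (0 : ℂ) r').isPreconnected
    (mem_ball_self hr'0) hZd.differentiableOn hg.continuousOn hZ0 hflow s₀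
    (mem_ball_zero_iff.mpr hs₀r') hz

end General

section Wilson

variable [NeZero L]

/-- **COROLLARY F″ (Wilson action, convergence).** If `Z_L(s) = ∫ D[U] e^{-s S_W}` is zero-free
on `|s| < R`, the canonical constants' series (`wilsonConst`) converges to `Z_L′/Z_L` there; a
VOLUME-UNIFORM zero-free disc thus gives volume-uniform convergence of the constants (the converse
of THEOREM F′ for the constants' component). [cite: Luscher2010Trivializing, §4.5(b)] -/
theorem wilson_const_hasSum_of_zeroFree (B : SuBasis n) {R : ℝ}
    (hR : ∀ w : ℂ, ‖w‖ < R → complexMGF (fun U => -ambWilsonAction (coeConfig U))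
      (trivialMeasure (Matrix.specialUnitaryGroup (Fin n) ℂ) d L) w ≠ 0) {s : ℂ} (hs : ‖s‖ < R) :
    HasSum (fun k => (wilsonConst d L B k : ℂ) * s ^ k)
      (deriv (complexMGF (fun U => -ambWilsonAction (coeConfig U))
          (trivialMeasure (Matrix.specialUnitaryGroup (Fin n) ℂ) d L)) s /
        complexMGF (fun U => -ambWilsonAction (coeConfig U))
          (trivialMeasure (Matrix.specialUnitaryGroup (Fin n) ℂ) d L) s) :=
  IsLuscherSeries.hasSum_const_mul_pow_of_zeroFree (isLuscherSeries_wilsonSk B)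
    contDiff_ambWilsonAction (contDiff_wilsonSk B) hR hs

/-- **COROLLARY F″ (Wilson action, divergence).** A complex zero `s₀` of the volume-`L` Wilson
partition function makes the volume-`L` constants' series non-summable at every complex `s` with
`|s| > |s₀|`. [cite: Luscher2010Trivializing, §4.5(b)] -/
theorem wilson_const_not_summable_of_actionZ_eq_zero (B : SuBasis n) {s₀ : ℂ}
    (hz : complexMGF (fun U => -ambWilsonAction (coeConfig U))
      (trivialMeasure (Matrix.specialUnitaryGroup (Fin n) ℂ) d L) s₀ = 0)
    {s : ℂ} (hs : ‖s₀‖ < ‖s‖) : ¬ Summable fun k => (wilsonConst d L B k : ℂ) * s ^ k :=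
  IsLuscherSeries.not_summable_const_mul_pow_of_actionZ_eq_zero (isLuscherSeries_wilsonSk B)
    contDiff_ambWilsonAction (contDiff_wilsonSk B) hz hs

/-- **COROLLARY F″ (Wilson action, real flow parameters).** A complex zero `s₀` of `Z_L` makes
the REAL series `∑_k Ċ^{(k)}_L t^k` (Lüscher's flow-constant series at flow parameter `t`, in the
units `s = tβ/N`) diverge at every real `|t| > |s₀|`. [cite: Luscher2010Trivializing, §4.5(b)] -/
theorem wilson_const_not_summable_real (B : SuBasis n) {s₀ : ℂ}
    (hz : complexMGF (fun U => -ambWilsonAction (coeConfig U))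
      (trivialMeasure (Matrix.specialUnitaryGroup (Fin n) ℂ) d L) s₀ = 0)
    {t : ℝ} (ht : ‖s₀‖ < |t|) : ¬ Summable fun k => wilsonConst d L B k * t ^ k := by
  intro hsum
  refine wilson_const_not_summable_of_actionZ_eq_zero B hz (s := (t : ℂ))
    (by rwa [norm_real, Real.norm_eq_abs]) ?_
  simpa [ofReal_mul, ofReal_pow] using summable_ofReal.mpr hsum

end Wilson

end Summit.Ventures.LatticeQCDFlow.TrivializingMaps
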